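import Summits.QuantumFields.BalabanUV.Beta.StepReflectionRec
import Summits.QuantumFields.BalabanUV.Beta.RecursiveStencilSlot
import Summits.QuantumFields.BalabanUV.Beta.E3ContactGenerator

/-!
# `BalabanUV.Beta.StepReflectionRecSlot` — binder row D1, RULING R-D1-g28-2 FILE E3: THE (Sr-conj) LAW AT MEMBER `j+1` OF THE SLOTTED RECURSIVE
# FAMILY `SrecOf V H G …` MODULO THE ff-LAW OF ITS CUBIC SECTOR — the slot-generic twin of `StepReflectionRec.cubicStep_bref_of_ffLaw` ∕
# `SrecAt_succ_bref_of_e3Law`: the comb's `vhSAt ρ_c`∕`hessFFAt ρ_c`∕`bhKAt ρ_c`∕`ctGen` replaced by table slots `V`∕`H`, a level-0 spread `B₀` and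
# the border-reading generator `ctGenM B₀`, with the tables' reflection letters (V-r) (three border blocks), (V-ff0), (H-r) DISPLAYED as hypotheses

HONEST FRAMING (cell charter, verbatim): «discharging BetaPertH makes Balaban's UV stability UNCONDITIONAL — a real constructive-QFT result; it is
NOT the continuum limit and NOT the Clay problem.»  HONEST DEPENDENCY: continuum YM on T⁴ ⇐ BetaPertH ∧ nine spine estimates (0/9 proved); BetaPertH
⇐ (D1) ∧ (D4) ∧ CAP+tail; G-an2-4 gates asym, D1 and NE2/3/4.  DERIVED cell leaf (β sub-cell, BINDER-OWNERS row D1 OWNER `b2b-balaban-beta-an2`, gen 28).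
THE LETTERS (about the table slots and a level-0 spread `B₀`; for the (0.4) literal `B₀ = bhK Lc + Dsh`, `V = tabs.V`, `H = tabs.H`):
(V-r) on a leg pair `(a, b)`: `V κ′ (bref α κ′ u) x z a b = (reflSign α κ′ • refK (Φ Lc α) (V κ′ u + conjV B₀ ((Lc^{d+1})⁻¹ • diagK (ctGenM d B₀ α Lc κ′ u)))) x z a b`
— asked on the three border leg pairs `(inl, inr)`, `(inr, inl)`, `(inr, inr)`; (V-ff0) `V κ u x z (inl β) (inl β′) = 0`; (H-r) `H μ (bref α μ y) = reflSign α μ • refK (Φ Lc α) (H μ y)`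
(pure sign).  For the comb these are an5∕an2's `vhSAt_bref` rows (`VhPieceReflection`, `VhSliceReflectionScaled`) and `RootedKernelReflection.hessFFAt_reflect`.
WHAT ([folklore]): §1 `smul_slot_bref_of_border` — one border leg pair: from (V-r) there and «`𝕄` agrees with `s • B₀` there», the scaled letter
`(c • V κ′ (bref α κ′ u)) x z a b = (ε • refK Φ (c • V κ′ u + conjV 𝕄 ((c/(s·Lc^{d+1})) • diagK (ctGenM d B₀ α Lc κ′ u)))) x z a b`; §2 the Λ slice with a
generic Hessian table: `SLam_lamCoeffK_reflect_slot`, `smul_SLam_step_reflect_slot` (pure sign from (H-r), `LambdaPieceReflection.SLam_reflect` +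
`StepLambdaReflection.lamCoeffK_reflect (refK_comp_KInvStep_E2 j α)`); §3 **`cubicStep_bref_of_ffLaw_slot`** (generic ff-supported cubic sector `Q` with
its ff-law, weight `a`, `a·c = cVH·wVH j∕(s·Lc^{d+1})`); §4 **`SrecOf_succ_bref_of_e3Law`** (member `j+1` of `SrecOf V H G cE cVH cΛ`: `Q := e3OfK Lc (G j) (SrecOf … j)`,
`a := cE·wE (j+1)`).
HONEST: bookkeeping; (V-r)(V-ff0)(H-r), the spread's border agreement and the cubic ff-law are HYPOTHESES; discharges NOTHING of the row: root-level classes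
0∕5; tables 0∕5; NOT D1, NOT `BetaPertH`, NOT continuum, NOT Clay.  No statement of Bałaban's papers, no `[cite:]`, no `Prop` fact, no `def`.
Provenance: β sub-cell, unit beta-an2 gen 28, 2026-08-21 (v1); pattern `StepReflectionRec` (an2 gen 16) BY NAME; no existing file touched.
-/

open Finset
open scoped BigOperators
open Literature.MathematicalPhysics.QuantumFieldTheory
open Literature.MathematicalPhysics.QuantumFieldTheory.Balaban1983to89
open Literature.MathematicalPhysics.QuantumFieldTheory.Balaban1983to89.Beta
open ExpKernelCalculus (MKer comp)
open AveragingContoursRooted (ctr ctrOff)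
open PolarizationSign (reflSign)
open KernelReflection (LegMap refK refK_apply)
open ResolventReflection (bref Φ Φ_r_inl Φ_r_inr Φ_s_inl Φ_s_inr)
open OneStepResolventKernel (Fib KInv)
open OneStepKernelFamily (KInvStep)
open InterLevelTransport (SLam)
open BalabanStepJetsSucc (mmRead E2 lamCoeffK wE wVH wΛ)
open Summit.QuantumFields.BalabanUV.Beta.ChartConjugation (conjV)
open Summit.QuantumFields.BalabanUV.Beta.BorderedHessian (diagK conjV_diagK_apply)
open Summit.QuantumFields.BalabanUV.Beta.WardLocusRecursive (SrecOf SrecOf_succ)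
open Summit.QuantumFields.BalabanUV.Beta.E3ContactGenerator (ctGenM)
open Summit.QuantumFields.BalabanUV.Beta.SpineRooted (e3OfK e3OfK_inl_inr e3OfK_inr_inl e3OfK_inr_inr conjV_smul_right SLam_reflect lamCoeffK_reflect
  refK_comp_KInvStep_E2)

noncomputable section

namespace Summit.QuantumFields.BalabanUV.Beta.StepReflectionRecSlot

variable {d : ℕ} {Lc : ℕ} [NeZero Lc]

/-! ## §1 One border leg pair: the scaled table letter against a kernel agreeing with `s • B₀` there -/

/-- [folklore] **THE SCALED (V-r) LETTER ON ONE LEG PAIR.**  If `𝕄 x z a b = s · B₀ x z a b` for all `x z` at the leg pair `(a, b)` (`s ≠ 0`), and the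
table `V` obeys (V-r) there against `B₀` with coefficient `(Lc^{d+1})⁻¹`, then `c • V` obeys it against `𝕄` with coefficient `c/(s·Lc^{d+1})`. -/
theorem smul_slot_bref_of_border {V : Fin (d + 1) → (Fin (d + 1) → ℤ) → MKer (d + 1) (Fib d)} {B₀ 𝕄 : MKer (d + 1) (Fib d)} {s : ℝ} (hs : s ≠ 0)
    (c : ℝ) {α κ' : Fin (d + 1)} {u : Fin (d + 1) → ℤ} {a b : Fib d}
    (h𝕄 : ∀ x z, 𝕄 x z a b = s * B₀ x z a b)
    (hV : ∀ x z, V κ' (bref α κ' u) x z a b = (reflSign α κ' • refK (Φ (d := d) Lc α)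
      (V κ' u + conjV B₀ ((((Lc : ℝ) ^ (d + 1))⁻¹) • diagK (ctGenM d B₀ α Lc κ' u)))) x z a b)
    (x z : Fin (d + 1) → ℤ) :
    (c • V κ' (bref α κ' u)) x z a b = (reflSign α κ' • refK (Φ (d := d) Lc α)
      (c • V κ' u + conjV 𝕄 ((c / (s * (Lc : ℝ) ^ (d + 1))) • diagK (ctGenM d B₀ α Lc κ' u)))) x z a b := by
  have hL : ((Lc : ℝ) ^ (d + 1)) ≠ 0 := pow_ne_zero _ (by exact_mod_cast NeZero.ne Lc)
  have hc : ∀ x' z', conjV 𝕄 (diagK (ctGenM d B₀ α Lc κ' u)) x' z' a b = s * conjV B₀ (diagK (ctGenM d B₀ α Lc κ' u)) x' z' a b := fun x' z' => by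
    rw [conjV_diagK_apply, conjV_diagK_apply, h𝕄, mul_assoc]
  simp only [Pi.smul_apply, Pi.add_apply, smul_eq_mul, refK_apply, conjV_smul_right, hc]
  rw [hV x z]
  simp only [Pi.smul_apply, Pi.add_apply, smul_eq_mul, refK_apply, conjV_smul_right]
  field_simp

/-- [folklore] **THE FIELD–FIELD BLOCK OF A SCALED TABLE WITHOUT FIELD BLOCK VANISHES** ((V-ff0)). -/
theorem smul_slot_inl_inl {V : Fin (d + 1) → (Fin (d + 1) → ℤ) → MKer (d + 1) (Fib d)}
    (hV0 : ∀ (κ : Fin (d + 1)) (w x z : Fin (d + 1) → ℤ) (β β' : Fin (d + 1)), V κ w x z (Sum.inl β) (Sum.inl β') = 0)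
    (c : ℝ) (κ' : Fin (d + 1)) (w x z : Fin (d + 1) → ℤ) (β β' : Fin (d + 1)) : (c • V κ' w) x z (Sum.inl β) (Sum.inl β') = 0 := by
  rw [Pi.smul_apply, Pi.smul_apply, Pi.smul_apply, Pi.smul_apply, smul_eq_mul, hV0, mul_zero]

/-! ## §2 The Λ slice with a generic Hessian table reflects by a pure sign -/

/-- [folklore] **THE Λ-STENCIL WITH A GENERIC HESSIAN TABLE OBEYS (Sr) WITH NO CONTACT** at every level `j`, given (H-r). -/
theorem SLam_lamCoeffK_reflect_slot {H : Fin (d + 1) → (Fin (d + 1) → ℤ) → MKer (d + 1) (Fib d)}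
    (hH : ∀ (α μ : Fin (d + 1)) (y : Fin (d + 1) → ℤ), H μ (bref α μ y) = reflSign α μ • refK (Φ (d := d) Lc α) (H μ y))
    (j : ℕ) (α κ' : Fin (d + 1)) (u : Fin (d + 1) → ℤ) :
    SLam Lc (lamCoeffK (KInvStep (d := d) Lc j) (E2 d Lc j) Lc) H κ' (bref α κ' u) =
      reflSign α κ' • refK (Φ Lc α) (SLam Lc (lamCoeffK (KInvStep (d := d) Lc j) (E2 d Lc j) Lc) H κ' u) :=
  SLam_reflect (fun μ y κ'' u' => lamCoeffK_reflect (refK_comp_KInvStep_E2 j α) μ y κ'' u') (fun μ y => hH α μ y) κ' u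

/-- [folklore] The same with the step weight `cΛ·wΛ j`. -/
theorem smul_SLam_step_reflect_slot {H : Fin (d + 1) → (Fin (d + 1) → ℤ) → MKer (d + 1) (Fib d)}
    (hH : ∀ (α μ : Fin (d + 1)) (y : Fin (d + 1) → ℤ), H μ (bref α μ y) = reflSign α μ • refK (Φ (d := d) Lc α) (H μ y))
    (cΛ : ℝ) (j : ℕ) (α κ' : Fin (d + 1)) (u : Fin (d + 1) → ℤ) :
    (cΛ * wΛ d Lc j) • SLam Lc (lamCoeffK (KInvStep (d := d) Lc j) (E2 d Lc j) Lc) H κ' (bref α κ' u) =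
      reflSign α κ' • refK (Φ Lc α) ((cΛ * wΛ d Lc j) • SLam Lc (lamCoeffK (KInvStep (d := d) Lc j) (E2 d Lc j) Lc) H κ' u) := by
  rw [SLam_lamCoeffK_reflect_slot hH j α κ' u]
  funext x z a b
  simp only [Pi.smul_apply, smul_eq_mul, refK_apply]
  ring

/-! ## §3 The law for a step stencil with a generic cubic sector and table slots -/

/-- [folklore] **(Sr-conj) FOR A SLOTTED STEP STENCIL WITH A GENERIC FIELD–FIELD CUBIC SECTOR, MODULO ITS ff-LAW WITH CONTACT.**  Data: a cubic
sector `Q` on the field–field block (`hQfm`, `hQmf`, `hQmm`) with weight `a`; the border table `(cVH·wVH j) • V` with (V-r) on the three border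
leg pairs against `B₀` and (V-ff0); the Λ sector with (H-r); a kernel `𝕄` agreeing with `s • B₀` on the three border leg pairs (`s ≠ 0`); the ff-law
`hQff` of `Q` with contact constant `c` and generator `ctGenM d B₀`; `a·c = cVH·wVH j / (s·Lc^{d+1})`.  Conclusion: hSrC for
`T κ′ u′ := a • Q κ′ u′ + (cVH·wVH j) • V κ′ u′ + (cΛ·wΛ j) • SLam …H κ′ u′` with contact `(cVH·wVH j / (s·Lc^{d+1})) • diagK (ctGenM d B₀ α Lc κ′ u)`. -/
theorem cubicStep_bref_of_ffLaw_slot {V H : Fin (d + 1) → (Fin (d + 1) → ℤ) → MKer (d + 1) (Fib d)} {B₀ 𝕄 : MKer (d + 1) (Fib d)}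
    (cVH cΛ : ℝ) (j : ℕ) {s : ℝ} (hs : s ≠ 0) {α : Fin (d + 1)}
    (hfm : ∀ x z β μ, 𝕄 x z (Sum.inl β) (Sum.inr μ) = s * B₀ x z (Sum.inl β) (Sum.inr μ))
    (hmf : ∀ x z μ β, 𝕄 x z (Sum.inr μ) (Sum.inl β) = s * B₀ x z (Sum.inr μ) (Sum.inl β))
    (hmm : ∀ x z μ μ', 𝕄 x z (Sum.inr μ) (Sum.inr μ') = s * B₀ x z (Sum.inr μ) (Sum.inr μ'))
    (hVfm : ∀ (κ' : Fin (d + 1)) (u x z : Fin (d + 1) → ℤ) (β μ : Fin (d + 1)), V κ' (bref α κ' u) x z (Sum.inl β) (Sum.inr μ) =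
      (reflSign α κ' • refK (Φ (d := d) Lc α) (V κ' u + conjV B₀ ((((Lc : ℝ) ^ (d + 1))⁻¹) • diagK (ctGenM d B₀ α Lc κ' u)))) x z (Sum.inl β) (Sum.inr μ))
    (hVmf : ∀ (κ' : Fin (d + 1)) (u x z : Fin (d + 1) → ℤ) (μ β : Fin (d + 1)), V κ' (bref α κ' u) x z (Sum.inr μ) (Sum.inl β) =
      (reflSign α κ' • refK (Φ (d := d) Lc α) (V κ' u + conjV B₀ ((((Lc : ℝ) ^ (d + 1))⁻¹) • diagK (ctGenM d B₀ α Lc κ' u)))) x z (Sum.inr μ) (Sum.inl β))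
    (hVmm : ∀ (κ' : Fin (d + 1)) (u x z : Fin (d + 1) → ℤ) (μ μ' : Fin (d + 1)), V κ' (bref α κ' u) x z (Sum.inr μ) (Sum.inr μ') =
      (reflSign α κ' • refK (Φ (d := d) Lc α) (V κ' u + conjV B₀ ((((Lc : ℝ) ^ (d + 1))⁻¹) • diagK (ctGenM d B₀ α Lc κ' u)))) x z (Sum.inr μ) (Sum.inr μ'))
    (hV0 : ∀ (κ : Fin (d + 1)) (w x z : Fin (d + 1) → ℤ) (β β' : Fin (d + 1)), V κ w x z (Sum.inl β) (Sum.inl β') = 0)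
    (hH : ∀ (α' μ : Fin (d + 1)) (y : Fin (d + 1) → ℤ), H μ (bref α' μ y) = reflSign α' μ • refK (Φ (d := d) Lc α') (H μ y))
    {Q : Fin (d + 1) → (Fin (d + 1) → ℤ) → MKer (d + 1) (Fib d)}
    (hQfm : ∀ κ' w x z β μ, Q κ' w x z (Sum.inl β) (Sum.inr μ) = 0) (hQmf : ∀ κ' w x z μ β, Q κ' w x z (Sum.inr μ) (Sum.inl β) = 0)
    (hQmm : ∀ κ' w x z μ μ', Q κ' w x z (Sum.inr μ) (Sum.inr μ') = 0) (a c : ℝ)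
    (hc : a * c = cVH * wVH d Lc j / (s * (Lc : ℝ) ^ (d + 1)))
    (hQff : ∀ (κ' : Fin (d + 1)) (u x z : Fin (d + 1) → ℤ) (β β' : Fin (d + 1)),
      Q κ' (bref α κ' u) x z (Sum.inl β) (Sum.inl β') =
        reflSign α κ' * ((Φ Lc α).s (Sum.inl β) * (Φ Lc α).s (Sum.inl β') *
          (Q κ' u ((Φ Lc α).r (Sum.inl β) x) ((Φ Lc α).r (Sum.inl β') z) (Sum.inl β) (Sum.inl β') +
            c * conjV 𝕄 (diagK (ctGenM d B₀ α Lc κ' u)) ((Φ Lc α).r (Sum.inl β) x) ((Φ Lc α).r (Sum.inl β') z) (Sum.inl β) (Sum.inl β'))))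
    (T : Fin (d + 1) → (Fin (d + 1) → ℤ) → MKer (d + 1) (Fib d))
    (hT : ∀ κ' u', T κ' u' = a • Q κ' u' + (cVH * wVH d Lc j) • V κ' u' +
      (cΛ * wΛ d Lc j) • SLam Lc (lamCoeffK (KInvStep (d := d) Lc j) (E2 d Lc j) Lc) H κ' u')
    (κ' : Fin (d + 1)) (u : Fin (d + 1) → ℤ) :
    T κ' (bref α κ' u) =
      reflSign α κ' • refK (Φ Lc α) (T κ' u + conjV 𝕄 ((cVH * wVH d Lc j / (s * (Lc : ℝ) ^ (d + 1))) • diagK (ctGenM d B₀ α Lc κ' u))) := by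
  -- the Λ summand: pure sign, entrywise
  have hΛ := smul_SLam_step_reflect_slot (d := d) (Lc := Lc) hH cΛ j α κ' u
  rw [hT, hT]
  funext x z e f
  have hΛx := congrFun (congrFun (congrFun (congrFun hΛ x) z) e) f
  simp only [Pi.smul_apply, smul_eq_mul, refK_apply] at hΛx
  simp only [Pi.smul_apply, Pi.add_apply, smul_eq_mul, refK_apply, conjV_smul_right]
  rcases e with β | μ <;> rcases f with β' | μ'
  · -- field–field: the cubic sector carries the contact, V vanishes, Λ pure sign
    rw [hQff κ' u x z β β', hΛx]
    have hv0 := smul_slot_inl_inl hV0 (cVH * wVH d Lc j) κ' (bref α κ' u) x z β β'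
    have hv1 := smul_slot_inl_inl hV0 (cVH * wVH d Lc j) κ' u ((Φ Lc α).r (Sum.inl β) x) ((Φ Lc α).r (Sum.inl β') z) β β'
    simp only [Pi.smul_apply, smul_eq_mul] at hv0 hv1
    rw [hv0, hv1]
    have hc' : cVH * wVH d Lc j / (s * (Lc : ℝ) ^ (d + 1)) = a * c := hc.symm
    rw [hc']
    ring
  · -- field–multiplier: V carries the contact, the cubic sector vanishes
    have hv := smul_slot_bref_of_border (Lc := Lc) hs (cVH * wVH d Lc j) (fun x' z' => hfm x' z' β μ') (fun x' z' => hVfm κ' u x' z' β μ') x z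
    simp only [Pi.smul_apply, Pi.add_apply, smul_eq_mul, refK_apply, conjV_smul_right] at hv
    rw [hQfm, hQfm, hv, hΛx]
    ring
  · have hv := smul_slot_bref_of_border (Lc := Lc) hs (cVH * wVH d Lc j) (fun x' z' => hmf x' z' μ β') (fun x' z' => hVmf κ' u x' z' μ β') x z
    simp only [Pi.smul_apply, Pi.add_apply, smul_eq_mul, refK_apply, conjV_smul_right] at hv
    rw [hQmf, hQmf, hv, hΛx]
    ring
  · have hv := smul_slot_bref_of_border (Lc := Lc) hs (cVH * wVH d Lc j) (fun x' z' => hmm x' z' μ μ') (fun x' z' => hVmm κ' u x' z' μ μ') x z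
    simp only [Pi.smul_apply, Pi.add_apply, smul_eq_mul, refK_apply, conjV_smul_right] at hv
    rw [hQmm, hQmm, hv, hΛx]
    ring

/-! ## §4 Member `j+1` of the slotted recursive family -/

/-- [folklore] **(Sr-conj) AT MEMBER `j+1` OF `SrecOf V H G cE cVH cΛ`, MODULO THE ff-LAW OF ITS CUBIC SECTOR.**  If `e3OfK Lc (G j) (SrecOf … j)` obeys
the ff-law with contact `c·conjV 𝕄 (diagK (ctGenM d B₀ α Lc κ′ u))` against a kernel `𝕄` agreeing with `s • B₀` on the border leg pairs (`s ≠ 0`) and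
`cE·wE (j+1)·c = cVH·wVH (j+1) / (s·Lc^{d+1})`, and the tables obey (V-r)(V-ff0)(H-r), then
`SrecOf … (j+1) κ′ (bref α κ′ u) = reflSign α κ′ • refK (Φ Lc α) (SrecOf … (j+1) κ′ u + conjV 𝕄 ((cVH·wVH (j+1) / (s·Lc^{d+1})) • diagK (ctGenM d B₀ α Lc κ′ u)))`. -/
theorem SrecOf_succ_bref_of_e3Law {V H : Fin (d + 1) → (Fin (d + 1) → ℤ) → MKer (d + 1) (Fib d)} (G : ℕ → MKer (d + 1) (Fib d))
    {B₀ 𝕄 : MKer (d + 1) (Fib d)} (cE cVH cΛ : ℝ) (j : ℕ) {s : ℝ} (hs : s ≠ 0) {α : Fin (d + 1)}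
    (hfm : ∀ x z β μ, 𝕄 x z (Sum.inl β) (Sum.inr μ) = s * B₀ x z (Sum.inl β) (Sum.inr μ))
    (hmf : ∀ x z μ β, 𝕄 x z (Sum.inr μ) (Sum.inl β) = s * B₀ x z (Sum.inr μ) (Sum.inl β))
    (hmm : ∀ x z μ μ', 𝕄 x z (Sum.inr μ) (Sum.inr μ') = s * B₀ x z (Sum.inr μ) (Sum.inr μ'))
    (hVfm : ∀ (κ' : Fin (d + 1)) (u x z : Fin (d + 1) → ℤ) (β μ : Fin (d + 1)), V κ' (bref α κ' u) x z (Sum.inl β) (Sum.inr μ) =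
      (reflSign α κ' • refK (Φ (d := d) Lc α) (V κ' u + conjV B₀ ((((Lc : ℝ) ^ (d + 1))⁻¹) • diagK (ctGenM d B₀ α Lc κ' u)))) x z (Sum.inl β) (Sum.inr μ))
    (hVmf : ∀ (κ' : Fin (d + 1)) (u x z : Fin (d + 1) → ℤ) (μ β : Fin (d + 1)), V κ' (bref α κ' u) x z (Sum.inr μ) (Sum.inl β) =
      (reflSign α κ' • refK (Φ (d := d) Lc α) (V κ' u + conjV B₀ ((((Lc : ℝ) ^ (d + 1))⁻¹) • diagK (ctGenM d B₀ α Lc κ' u)))) x z (Sum.inr μ) (Sum.inl β))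
    (hVmm : ∀ (κ' : Fin (d + 1)) (u x z : Fin (d + 1) → ℤ) (μ μ' : Fin (d + 1)), V κ' (bref α κ' u) x z (Sum.inr μ) (Sum.inr μ') =
      (reflSign α κ' • refK (Φ (d := d) Lc α) (V κ' u + conjV B₀ ((((Lc : ℝ) ^ (d + 1))⁻¹) • diagK (ctGenM d B₀ α Lc κ' u)))) x z (Sum.inr μ) (Sum.inr μ'))
    (hV0 : ∀ (κ : Fin (d + 1)) (w x z : Fin (d + 1) → ℤ) (β β' : Fin (d + 1)), V κ w x z (Sum.inl β) (Sum.inl β') = 0)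
    (hH : ∀ (α' μ : Fin (d + 1)) (y : Fin (d + 1) → ℤ), H μ (bref α' μ y) = reflSign α' μ • refK (Φ (d := d) Lc α') (H μ y))
    (c : ℝ) (hc : cE * wE d Lc (j + 1) * c = cVH * wVH d Lc (j + 1) / (s * (Lc : ℝ) ^ (d + 1)))
    (hE3ff : ∀ (κ' : Fin (d + 1)) (u x z : Fin (d + 1) → ℤ) (β β' : Fin (d + 1)),
      e3OfK Lc (G j) (SrecOf d Lc V H G cE cVH cΛ j) κ' (bref α κ' u) x z (Sum.inl β) (Sum.inl β') =
        reflSign α κ' * ((Φ Lc α).s (Sum.inl β) * (Φ Lc α).s (Sum.inl β') *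
          (e3OfK Lc (G j) (SrecOf d Lc V H G cE cVH cΛ j) κ' u ((Φ Lc α).r (Sum.inl β) x) ((Φ Lc α).r (Sum.inl β') z) (Sum.inl β) (Sum.inl β') +
            c * conjV 𝕄 (diagK (ctGenM d B₀ α Lc κ' u)) ((Φ Lc α).r (Sum.inl β) x) ((Φ Lc α).r (Sum.inl β') z) (Sum.inl β) (Sum.inl β'))))
    (κ' : Fin (d + 1)) (u : Fin (d + 1) → ℤ) :
    SrecOf d Lc V H G cE cVH cΛ (j + 1) κ' (bref α κ' u) =
      reflSign α κ' • refK (Φ Lc α) (SrecOf d Lc V H G cE cVH cΛ (j + 1) κ' u +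
        conjV 𝕄 ((cVH * wVH d Lc (j + 1) / (s * (Lc : ℝ) ^ (d + 1))) • diagK (ctGenM d B₀ α Lc κ' u))) :=
  cubicStep_bref_of_ffLaw_slot cVH cΛ (j + 1) hs hfm hmf hmm hVfm hVmf hVmm hV0 hH
    (Q := e3OfK Lc (G j) (SrecOf d Lc V H G cE cVH cΛ j))
    (fun κ' w x z β μ => e3OfK_inl_inr _ _ _ κ' w x z β μ) (fun κ' w x z μ β => e3OfK_inr_inl _ _ _ κ' w x z μ β)
    (fun κ' w x z μ μ' => e3OfK_inr_inr _ _ _ κ' w x z μ μ') (cE * wE d Lc (j + 1)) c hc hE3ff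
    (SrecOf d Lc V H G cE cVH cΛ (j + 1)) (fun κ' u' => by rw [SrecOf_succ]) κ' u

end Summit.QuantumFields.BalabanUV.Beta.StepReflectionRecSlot

end
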